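import Mathlib.NumberTheory.Padics.HeightOneSpectrum
import Mathlib.NumberTheory.Padics.RingHoms
import Literature.NumberTheory.EllipticCurves.PadicPointsFiniteIndexProofs
import HarnessLib

/-!
# `E(ℚ_p)` is CYCLIC modulo `p` and torsion: `∃ Y, ∀ X, X = c • Y + p • Z + T` (AEC VII.6.3), also over the
# completion `ℚ_v` (theorems only — no definition, no named fact; nothing asserted about any curve's BSD)

HONEST FRAMING (cell `b2b-bsdres`, run/shared/lean/b2b/bsd-rank1-residual/, verbatim in every
file): the goal of the cell is to DELETE the COMBINATION-SHAPED residual classes of the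
Birch–Swinnerton-Dyer formula for ALL analytic-rank `≤ 1` elliptic curves over `ℚ` — "full BSD
formula for every rank `≤ 1` curve in class `C`" assembled STRICTLY from published theorems — so
that the rank-`≤ 1` remainder becomes exactly the CONSTRUCTION-SHAPED classes, which are TYPED
(missing-input `Prop`s), NOT attempted. This is not "finishing BSD". Seat `b2b-bsdres-additive-p3`
(X8 prover B / X7 joint; typer-designate for the cell conjecture C-16 = hyp C120.1 by hyp R-16 (e)).
This file books nothing and moves no mark; X7 / X8 stay CONSTRUCTION-SHAPED.

## What this file does

The surjectivity criterion of `Ordinary/StrictSelmerIndexRankOne.lean` («`Sel_{p^∞} = im κ + Sel_0`»,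
hence `#Sel_0 = p^{m_p} · #Ш[p^∞]`) needs ONE local input at the completion: the local Kummer part of
`H¹(ℚ_p, E[p^∞])` has at most `p` elements killed by `p` — equivalently `E(ℚ_p)/(p E(ℚ_p) + E(ℚ_p)_tors)`
is cyclic (of order `p`). This file proves the group-theoretic form of that input from Silverman AEC
Prop. VII.6.3 in the tree's form `exists_finiteIndex_addEquiv_padicInt_holds` (`E(ℚ_p)` has a finite-index
subgroup `≃+ ℤ_p`):
* §1 additive subgroups `H ≤ ℤ_p` containing `n ℤ_p` (`n ≠ 0`) are `p^j ℤ_p`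
  (`exists_pow_mul_mem_and_forall_eq` — minimal `j` with `p^j ℤ_p ⊆ H`, integer approximation
  `PadicInt.appr`), hence cyclic modulo `p`: `∃ h₀ ∈ H, ∀ h ∈ H, h = c • h₀ + p h'` with `h' ∈ H`
  (`exists_generator_mod_p`);
* §2 **`exists_generator_mod_p_add_torsion`**: for an elliptic curve `V/ℚ_p`,
  `∃ Y ∈ E(ℚ_p), ∀ X, ∃ (c : ℕ) Z T, T torsion ∧ X = c • Y + p • Z + T` (via `λ : E(ℚ_p) → ℤ_p`,
  `X ↦ e([E(ℚ_p):A] • X)`, kernel = torsion, image `⊇ [E(ℚ_p):A] ℤ_p`);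
* §3 the same over the completion `ℚ_v = v.adicCompletion ℚ` at the place `v ∋ p` (transport of points
  along Mathlib's `padicEquiv v : ℚ_v ≃ₐ[ℚ] ℚ_[p]`): `exists_generator_mod_p_add_torsion_adicCompletion`.

References: J. H. Silverman, AEC 2nd ed. (2009), Prop. VII.6.3 [SilvermanAEC2009]; C.-H. Kim, Amer. J. Math.
= arXiv:2203.12159, Lemma 5.1 («`H¹_{/f}(ℚ_p, T)` is free of rank one») [Kim2022StructureSelmer].
-/

noncomputable section

open scoped Classical

namespace Summit.BirchSwinnertonDyer.Rank1Residual.Ordinary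

/-! ### §1 Additive subgroups of `ℤ_p` containing `n ℤ_p` -/

section PadicSubgroups

variable {p : ℕ} [hp : Fact p.Prime]

/-- An additive subgroup `H ≤ ℤ_p` containing `n·ℤ_p` (`n ≠ 0` in `ℤ_p`) is `p^j ℤ_p` for some `j`:
`p^j ℤ_p ⊆ H` and every element of `H` is `p^j z`. (`j` = the least exponent with `p^j ℤ_p ⊆ H`; an
element of `H` of smaller valuation `j'` would give `p^{j'} ℤ_p ⊆ H` by integer approximation modulo
`p^{j-j'}`.) [folklore] -/
theorem exists_pow_mul_mem_and_forall_eq (H : AddSubgroup ℤ_[p]) {n : ℤ_[p]} (hn : n ≠ 0)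
    (hH : ∀ z : ℤ_[p], n * z ∈ H) :
    ∃ j : ℕ, (∀ z : ℤ_[p], (p : ℤ_[p]) ^ j * z ∈ H) ∧
      ∀ h ∈ H, ∃ z : ℤ_[p], h = (p : ℤ_[p]) ^ j * z := by
  -- `p^{v(n)} ℤ_p ⊆ H`
  have hex : ∃ j : ℕ, ∀ z : ℤ_[p], (p : ℤ_[p]) ^ j * z ∈ H := by
    refine ⟨n.valuation, fun z => ?_⟩
    set u := PadicInt.unitCoeff hn with hu
    have hspec : n = (u : ℤ_[p]) * (p : ℤ_[p]) ^ n.valuation := PadicInt.unitCoeff_spec hn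
    have key : n * (((u⁻¹ : ℤ_[p]ˣ) : ℤ_[p]) * z) = (p : ℤ_[p]) ^ n.valuation * z := by
      have h1 : ((u : ℤ_[p]) * (p : ℤ_[p]) ^ n.valuation) * (((u⁻¹ : ℤ_[p]ˣ) : ℤ_[p]) * z) =
          (p : ℤ_[p]) ^ n.valuation * z := by
        rw [mul_comm (u : ℤ_[p]), mul_assoc, ← mul_assoc (u : ℤ_[p]), Units.mul_inv, one_mul]
      rwa [← hspec] at h1
    rw [← key]
    exact hH _
  let j := Nat.find hex
  have hj : ∀ z : ℤ_[p], (p : ℤ_[p]) ^ j * z ∈ H := Nat.find_spec hex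
  refine ⟨j, hj, fun h hh => ?_⟩
  by_cases h0 : h = 0
  · exact ⟨0, by rw [h0, mul_zero]⟩
  rcases le_or_gt j h.valuation with hle | hlt
  · refine ⟨(PadicInt.unitCoeff h0 : ℤ_[p]) * (p : ℤ_[p]) ^ (h.valuation - j), ?_⟩
    conv_lhs => rw [PadicInt.unitCoeff_spec h0]
    rw [mul_left_comm, ← pow_add, Nat.add_sub_cancel' hle, mul_comm]
  · -- an element of valuation `j' < j` forces `p^{j'} ℤ_p ⊆ H`, contradicting minimality
    exfalso
    refine Nat.find_min hex hlt fun z => ?_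
    set k := h.valuation with hk
    set u := PadicInt.unitCoeff h0 with hu
    have hspec : h = (u : ℤ_[p]) * (p : ℤ_[p]) ^ k := PadicInt.unitCoeff_spec h0
    -- `u⁻¹ z = c + p^(j - k) t`
    set w : ℤ_[p] := ((u⁻¹ : ℤ_[p]ˣ) : ℤ_[p]) * z with hw
    have happr := PadicInt.appr_spec (j - k) w
    rw [Ideal.mem_span_singleton'] at happr
    obtain ⟨t, ht⟩ := happr
    set c : ℕ := PadicInt.appr w (j - k) with hc
    have h1 : z = (u : ℤ_[p]) * w := by
      rw [hw, ← mul_assoc, Units.mul_inv, one_mul]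
    have h2 : w = (c : ℤ_[p]) + t * (p : ℤ_[p]) ^ (j - k) := by
      rw [ht]; ring
    have hpj : (p : ℤ_[p]) ^ j = (p : ℤ_[p]) ^ k * (p : ℤ_[p]) ^ (j - k) := by
      rw [← pow_add, Nat.add_sub_cancel' hlt.le]
    have hz : (p : ℤ_[p]) ^ k * z = c • h + (p : ℤ_[p]) ^ j * (t * u) := by
      rw [h1, h2, nsmul_eq_mul, hspec, hpj]
      ring
    rw [hz]
    exact H.add_mem (H.nsmul_mem hh _) (hj _)

/-- **An additive subgroup `H ≤ ℤ_p` containing `n·ℤ_p` is cyclic modulo `p`**: there is `h₀ ∈ H` with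
every `h ∈ H` of the form `c • h₀ + p·h'`, `c ∈ ℕ`, `h' ∈ H` (`H = p^j ℤ_p`, `h₀ = p^j`). [folklore] -/
theorem exists_generator_mod_p (H : AddSubgroup ℤ_[p]) {n : ℤ_[p]} (hn : n ≠ 0)
    (hH : ∀ z : ℤ_[p], n * z ∈ H) :
    ∃ h₀ ∈ H, ∀ h ∈ H, ∃ (c : ℕ) (h' : ℤ_[p]), h' ∈ H ∧ h = c • h₀ + (p : ℤ_[p]) * h' := by
  obtain ⟨j, hj, hH'⟩ := exists_pow_mul_mem_and_forall_eq H hn hH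
  refine ⟨(p : ℤ_[p]) ^ j * 1, hj 1, fun h hh => ?_⟩
  obtain ⟨z, rfl⟩ := hH' h hh
  have happr := PadicInt.appr_spec 1 z
  rw [Ideal.mem_span_singleton', pow_one] at happr
  obtain ⟨t, ht⟩ := happr
  refine ⟨PadicInt.appr z 1, (p : ℤ_[p]) ^ j * t, hj t, ?_⟩
  have hz : z = (PadicInt.appr z 1 : ℤ_[p]) + t * (p : ℤ_[p]) := by rw [ht]; ring
  conv_lhs => rw [hz]
  rw [nsmul_eq_mul]
  ring

end PadicSubgroups

/-! ### §2 `E(ℚ_p)` is cyclic modulo `p` and torsion -/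

section LocalPoints

open WeierstrassCurve Literature.NumberTheory.EllipticCurves

variable (p : ℕ) [hp : Fact p.Prime]

/-- **`E(ℚ_p)/(p·E(ℚ_p) + E(ℚ_p)_tors)` is cyclic**: for an elliptic curve `V/ℚ_p` there is
`Y ∈ E(ℚ_p)` such that every `X ∈ E(ℚ_p)` is `c • Y + p • Z + T` with `c ∈ ℕ`, `Z ∈ E(ℚ_p)` and `T` of
finite order. From AEC VII.6.3 (`E(ℚ_p) ⊇ A ≅ ℤ_p` of finite index `n`; tree
`exists_finiteIndex_addEquiv_padicInt_holds`): `λ(X) = e(n • X)` has kernel the torsion and image an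
additive subgroup of `ℤ_p` containing `n ℤ_p`, cyclic modulo `p` by §1.
[cite: SilvermanAEC2009, Prop. VII.6.3] -/
theorem exists_generator_mod_p_add_torsion (V : WeierstrassCurve ℚ_[p]) [V.IsElliptic] :
    ∃ Y : V.toAffine.Point, ∀ X : V.toAffine.Point,
      ∃ (c : ℕ) (Z T : V.toAffine.Point), IsOfFinAddOrder T ∧ X = c • Y + p • Z + T := by
  obtain ⟨A, hA, ⟨e⟩⟩ := exists_finiteIndex_addEquiv_padicInt_holds p V
  haveI := hA
  have hidx : A.index ≠ 0 := AddSubgroup.FiniteIndex.index_ne_zero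
  let mulIdx : V.toAffine.Point →+ A :=
    AddMonoidHom.mk' (fun X => ⟨A.index • X, A.nsmul_index_mem X⟩) fun X Y =>
      Subtype.ext (smul_add (A.index) X Y)
  let lam : V.toAffine.Point →+ ℤ_[p] := e.toAddMonoidHom.comp mulIdx
  -- kernel = torsion
  have hlam : ∀ X, lam X = 0 → IsOfFinAddOrder X := by
    intro X h
    have h1 : mulIdx X = 0 := by
      have : e (mulIdx X) = 0 := h
      exact e.injective (this.trans (map_zero e).symm)
    have h2 : A.index • X = 0 := congrArg Subtype.val h1
    exact isOfFinAddOrder_iff_nsmul_eq_zero.mpr ⟨A.index, Nat.pos_of_ne_zero hidx, h2⟩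
  -- image ⊇ n ℤ_p
  have hn : ((A.index : ℕ) : ℤ_[p]) ≠ 0 := Nat.cast_ne_zero.mpr hidx
  have hH : ∀ z : ℤ_[p], ((A.index : ℕ) : ℤ_[p]) * z ∈ lam.range := by
    intro z
    refine ⟨((e.symm z : A) : V.toAffine.Point), ?_⟩
    have h1 : mulIdx ((e.symm z : A) : V.toAffine.Point) = A.index • e.symm z :=
      Subtype.ext rfl
    change e (mulIdx _) = _
    rw [h1, map_nsmul, AddEquiv.apply_symm_apply, nsmul_eq_mul]
  obtain ⟨h₀, ⟨Y, hY⟩, hgen⟩ := exists_generator_mod_p lam.range hn hH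
  refine ⟨Y, fun X => ?_⟩
  obtain ⟨c, h', ⟨Z, hZ⟩, hX⟩ := hgen (lam X) ⟨X, rfl⟩
  refine ⟨c, Z, X - c • Y - p • Z, hlam _ ?_, by abel⟩
  rw [map_sub, map_sub, map_nsmul, map_nsmul, hY, hZ, hX, nsmul_eq_mul (p : ℕ) h']
  ring

omit hp in
/-- The property «cyclic modulo `p` and torsion» is transported along additive isomorphisms. [folklore] -/
theorem exists_generator_mod_p_add_torsion_of_addEquiv {G G' : Type*} [AddCommGroup G]
    [AddCommGroup G'] (f : G ≃+ G')
    (h : ∃ Y : G, ∀ X : G, ∃ (c : ℕ) (Z T : G), IsOfFinAddOrder T ∧ X = c • Y + p • Z + T) :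
    ∃ Y : G', ∀ X : G', ∃ (c : ℕ) (Z T : G'), IsOfFinAddOrder T ∧ X = c • Y + p • Z + T := by
  obtain ⟨Y, hY⟩ := h
  refine ⟨f Y, fun X => ?_⟩
  obtain ⟨c, Z, T, hT, hX⟩ := hY (f.symm X)
  refine ⟨c, f Z, f T, f.toAddMonoidHom.isOfFinAddOrder hT, ?_⟩
  rw [← f.apply_symm_apply X, hX, map_add, map_add, map_nsmul, map_nsmul]

end LocalPoints

/-! ### §3 Over the completion `ℚ_v` at the place `v ∋ p` -/

section Completion

open WeierstrassCurve Rat.HeightOneSpectrum NumberField IsDedekindDomain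

variable (W : WeierstrassCurve ℚ) [W.IsElliptic] {p : ℕ} [hp : Fact p.Prime]
  {v : HeightOneSpectrum (𝓞 ℚ)}

omit [W.IsElliptic] hp in
/-- Base change of points along the `ℚ`-algebra identity is the identity. [folklore] -/
private theorem map_algHom_id_aux' {F : Type*} [Field F] [Algebra ℚ F]
    (Q : (W.baseChange F).toAffine.Point) : Affine.Point.map (AlgHom.id ℚ F) Q = Q := by
  cases Q <;> rfl

omit [W.IsElliptic] in
/-- **`E(ℚ_v) ≅ E(ℚ_p)`** for `E/ℚ` and the finite place `v ∋ p` of `ℚ`: transport of coordinates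
along Mathlib's `padicEquiv v : ℚ_v ≃ₐ[ℚ] ℚ_[primesEquiv v]`, `primesEquiv v = p` (public copy of the
tree's private `nonempty_pointAddEquiv_adicCompletion_padic`, `LocalPointsPlaceTransportProofs`). [folklore] -/
theorem nonempty_pointAddEquiv_adicCompletion_padic' (hpv : (p : 𝓞 ℚ) ∈ v.asIdeal) :
    Nonempty ((W.baseChange (v.adicCompletion ℚ)).toAffine.Point ≃+
      (W.baseChange ℚ_[p]).toAffine.Point) := by
  have hprim : ((primesEquiv v : Nat.Primes) : ℕ) = p := by
    have h : natGenerator v ∣ p := by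
      rw [natGenerator_dvd_iff, ← map_natCast (Rat.IsIntegralClosure.intEquiv (𝓞 ℚ)) p]
      exact Ideal.mem_map_of_mem _ hpv
    exact (Nat.prime_dvd_prime_iff_eq (prime_natGenerator v) hp.out).mp h
  obtain rfl := hprim
  let e : v.adicCompletion ℚ ≃ₐ[ℚ] ℚ_[(primesEquiv v : ℕ)] :=
    (adicCompletion.padicEquiv v).toAlgEquiv
  exact ⟨AddEquiv.ofBijective
    (Affine.Point.map (W' := W) (e : v.adicCompletion ℚ →ₐ[ℚ] ℚ_[(primesEquiv v : ℕ)]))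
    ⟨Affine.Point.map_injective (W' := W) _, fun Q ↦
      ⟨Affine.Point.map (W' := W) (e.symm : ℚ_[(primesEquiv v : ℕ)] →ₐ[ℚ] v.adicCompletion ℚ) Q,
        by rw [Affine.Point.map_map, AlgEquiv.comp_symm, map_algHom_id_aux']⟩⟩⟩

/-- **`E(ℚ_v)` is cyclic modulo `p` and torsion** at the place `v ∋ p` of `ℚ`: there is `Y ∈ E(ℚ_v)`
with every `X ∈ E(ℚ_v)` of the form `c • Y + p • Z + T`, `T` torsion (§2 transported along
`E(ℚ_v) ≅ E(ℚ_p)`). This is the local input «`E(ℚ_p) ⊗ ℚ_p/ℤ_p ≅ ℚ_p/ℤ_p`» (Kim 2022 Lemma 5.1) of the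
strict-Selmer count in group form. [cite: SilvermanAEC2009, Prop. VII.6.3] -/
theorem exists_generator_mod_p_add_torsion_adicCompletion (hpv : (p : 𝓞 ℚ) ∈ v.asIdeal) :
    ∃ Y : (W.baseChange (v.adicCompletion ℚ)).toAffine.Point,
      ∀ X : (W.baseChange (v.adicCompletion ℚ)).toAffine.Point,
        ∃ (c : ℕ) (Z T : (W.baseChange (v.adicCompletion ℚ)).toAffine.Point),
          IsOfFinAddOrder T ∧ X = c • Y + p • Z + T := by
  obtain ⟨f⟩ := nonempty_pointAddEquiv_adicCompletion_padic' W hpv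
  exact exists_generator_mod_p_add_torsion_of_addEquiv p f.symm
    (exists_generator_mod_p_add_torsion p (W.baseChange ℚ_[p]))

end Completion

end Summit.BirchSwinnertonDyer.Rank1Residual.Ordinary

end
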